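import Summits.Parity.BatemanHorn.Theses.RoughParitySectors
import Summits.Parity.BatemanHorn.Theorems.RoughParitySectorsRoughParityBalanceRoughCardLower
import Summits.Parity.BatemanHorn.Theorems.RoughParitySectorsOddSectorShareNonlinearExactness
import Literature.Barriers.Parity.UniformBatemanHornBarrierProofs
import Literature.NumberTheory.Sieve.LiouvillePolynomialValues
import HarnessLib

/-!
# STRATEGY-CENSUS gen 2 (strategist r1) — typed record for crux `RoughParityBalance` (stmt-Parity-15627)

Companion to `STRATEGY-CENSUS.md` (gen 2, this seat) of route `route-Parity-RoughParitySectors`.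
It records, kernel-checked and sorry-free, WHERE the crux sits:

* **Upper placement (conditional summit-equivalence, already in the tree):**
  `Summit.Parity.BatemanHorn.Cruxes.OddSectorShareNonlinear.Birth.roughParityBalance_iff_batemanHorn :
  OddSectorShareNonlinear → OddSectorShareLinear → (RoughParityBalance ↔ BatemanHorn)` — modulo the
  route's two share cruxes (stmt-Parity-15628/15629, open) the parity crux IS the summit; re-exported
  below as `summit_equivalence_within_cone`.
* **Lower placement (unconditional, NEW here):** `RoughParityBalance` implies, for EVERY one-polynomial
  Bateman–Horn system `f` (irreducible, positive leading coefficient, no fixed prime divisor, any degree),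
  that BOTH parities of `Ω(f(n))` occur for `≥ x/(3 (log x)^A)` integers `n ≤ x`, eventually
  (`signCounts_of_roughParityBalance`; `A = A(f)` from the landed rough-count floor
  `Birth.stub_roughCardLower`, p148773).  Specialised to `f = X³ + 2`
  (`Literature.Barriers.Parity.UniformBatemanHornMatrix.isBatemanHornSystem_X_pow_add_C`) this gives
  `problem_3_2_of_roughParityBalance : RoughParityBalance → ∀ N, ∃ n ≥ N, λ(n³+2) = −1`, i.e. a proof of
  the crux would settle **Teräväinen's Problem 3.2** ("Show that `λ(n³+2) = −1` for infinitely many natural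
  numbers `n`", J. Teräväinen, *On the Liouville function at polynomial arguments*, Amer. J. Math. 146
  (2024) = arXiv:2010.07924, §3.4 p. 7: "We do not make progress on Problems 3.1 and 3.2 in the present
  paper"; held as `paper:arxiv-2010.07924`, p0007), and in its quantitative form (`≫ x/(log x)^A` of each
  sign along every irreducible `f` of degree `≥ 2`) it exceeds everything in print for irreducible
  polynomials of degree `≥ 3` (loc. cit. §1: the sign-change conjecture "remains open for all but a few
  nonlinear polynomials").  So the crux, AS TYPED (all systems, in particular `k = 1`, `deg f ≥ 2`), is at
  least a named open problem in print — the theorem the tribunal asked for under outcome (3).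

Nothing here advances the crux; it is census evidence (crux-strategist protocol, `no-strategy` branch).
-/

namespace Summit.Parity.BatemanHorn.Cruxes.RoughParityBalance.StrategistR1

open scoped BigOperators Classical
open Filter Finset Polynomial
open Literature.NumberTheory.Sieve
open Summit.Parity.BatemanHorn.Theses.RoughParitySectors

/-! ### §1 Upper placement: summit-equivalence within the route's cone (re-export) -/

/-- Modulo the two share cruxes of the route, the parity crux is equivalent to Bateman–Horn
(re-export of the landed `Exactness` theorem, by name). [folklore] -/
theorem summit_equivalence_within_cone (hN : OddSectorShareNonlinear) (hL : OddSectorShareLinear) :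
    RoughParityBalance ↔ _root_.BatemanHorn :=
  Summit.Parity.BatemanHorn.Cruxes.OddSectorShareNonlinear.Birth.roughParityBalance_iff_batemanHorn hN hL

/-! ### §2 Lower placement: both parities with density `≫ x/(log x)^A` along every BH polynomial -/

/-- Elementary cell extraction: if `|2·c − r| ≤ r/3` and `L ≤ r` then both `c` and `r − c` are
`≥ L/3` (instance-generic in the decidability of `P`, so that it unifies with the route's own
filters). [folklore] -/
theorem cells_lower_of_balance {R : Finset ℕ} {P : ℕ → Prop} [DecidablePred P] {L : ℝ}
    (hB : |(2 : ℝ) ^ 1 * (((R.filter P).card : ℕ) : ℝ) - ((R.card : ℕ) : ℝ)| ≤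
      (1 / 3) * ((R.card : ℕ) : ℝ))
    (hL : L ≤ ((R.card : ℕ) : ℝ)) :
    L ≤ 3 * (((R.filter P).card : ℕ) : ℝ) ∧
      L ≤ 3 * (((R.filter fun n => ¬ P n).card : ℕ) : ℝ) := by
  have hsplit : (((R.filter P).card : ℕ) : ℝ) + (((R.filter fun n => ¬ P n).card : ℕ) : ℝ) =
      ((R.card : ℕ) : ℝ) := by
    exact_mod_cast Finset.card_filter_add_card_filter_not (s := R) (p := P)
  rw [abs_le] at hB
  obtain ⟨h1, h2⟩ := hB
  constructor
  · nlinarith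
  · nlinarith

/-- **Lower placement.**  `RoughParityBalance` implies: for every one-polynomial Bateman–Horn system
`f` there is `A` such that, eventually in `x`, both `#{n ≤ x : f(n) > 0, Ω(f(n)) odd}` and
`#{n ≤ x : f(n) > 0, Ω(f(n)) even}` are `≥ x / (3 (log x)^A)`.  Proof: the crux at `k = 1`,
`δ = 1/3` on the rough set `R_f(x,U)` plus the landed floor `#R_f(x,U) ≥ x/(log x)^A`
(`Birth.stub_roughCardLower`), then drop the roughness condition. [folklore] -/
theorem signCounts_of_roughParityBalance (hP : RoughParityBalance)
    (f : Polynomial ℤ) (hf : IsBatemanHornSystem ![f]) :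
    ∃ A : ℝ, ∀ᶠ x : ℕ in atTop,
      (x : ℝ) / Real.log x ^ A ≤ 3 * ((((Finset.Icc 1 x).filter (fun n : ℕ =>
          0 < f.eval (n : ℤ) ∧ Odd (ArithmeticFunction.cardFactors ((f.eval (n : ℤ)).toNat)))).card : ℕ) : ℝ) ∧
      (x : ℝ) / Real.log x ^ A ≤ 3 * ((((Finset.Icc 1 x).filter (fun n : ℕ =>
          0 < f.eval (n : ℤ) ∧ ¬ Odd (ArithmeticFunction.cardFactors ((f.eval (n : ℤ)).toNat)))).card : ℕ) : ℝ) := by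
  obtain ⟨A, U₁, hR⟩ := Birth.stub_roughCardLower 1 ![f] hf
  obtain ⟨U₀, hB⟩ := hP 1 ![f] hf (1 / 3) (by norm_num)
  refine ⟨A, ?_⟩
  filter_upwards [hR (max U₀ U₁) (le_max_right _ _), hB (max U₀ U₁) (le_max_left _ _)] with x hRx hBx
  obtain ⟨hodd, heven⟩ := cells_lower_of_balance hBx hRx
  constructor
  · refine hodd.trans ?_
    refine mul_le_mul_of_nonneg_left ?_ (by norm_num)
    refine Nat.cast_le.mpr (Finset.card_le_card ?_)
    intro n hn
    simp only [Finset.mem_filter, Fin.forall_fin_one, Matrix.cons_val_zero] at hn ⊢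
    exact ⟨hn.1.1, hn.1.2.1, hn.2⟩
  · refine heven.trans ?_
    refine mul_le_mul_of_nonneg_left ?_ (by norm_num)
    refine Nat.cast_le.mpr (Finset.card_le_card ?_)
    intro n hn
    simp only [Finset.mem_filter, Fin.forall_fin_one, Matrix.cons_val_zero] at hn ⊢
    exact ⟨hn.1.1, hn.1.2.1, hn.2⟩

/-- Growth: eventually `√x ≤ x/(log x)^A` along the naturals (from Mathlib's
`isLittleO_log_rpow_rpow_atTop`). [folklore] -/
theorem eventually_sqrt_le_div_log_rpow (A : ℝ) :
    ∀ᶠ x : ℕ in atTop, Real.sqrt x ≤ (x : ℝ) / Real.log x ^ A := by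
  have hlo := (isLittleO_log_rpow_rpow_atTop A (by norm_num : (0 : ℝ) < 1 / 2)).bound
    (by norm_num : (0 : ℝ) < 1)
  have hnat := tendsto_natCast_atTop_atTop.eventually hlo
  filter_upwards [hnat, eventually_ge_atTop 2] with x hx hx2
  have hxpos : (0 : ℝ) < x := by exact_mod_cast (show 0 < x by omega)
  have hlogpos : 0 < Real.log x := Real.log_pos (by exact_mod_cast (show 1 < x by omega))
  have hpowpos : 0 < Real.log x ^ A := Real.rpow_pos_of_pos hlogpos A
  rw [Real.norm_of_nonneg hpowpos.le, one_mul,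
    Real.norm_of_nonneg (Real.rpow_nonneg hxpos.le _)] at hx
  have hhalf : (x : ℝ) ^ (1 / 2 : ℝ) * (x : ℝ) ^ (1 / 2 : ℝ) = x := by
    rw [← Real.rpow_add hxpos]; norm_num
  have hsqpos : 0 < (x : ℝ) ^ (1 / 2 : ℝ) := Real.rpow_pos_of_pos hxpos _
  calc Real.sqrt x = (x : ℝ) ^ (1 / 2 : ℝ) := Real.sqrt_eq_rpow _
    _ = (x : ℝ) / (x : ℝ) ^ (1 / 2 : ℝ) := by
        rw [eq_div_iff hsqpos.ne']
        exact hhalf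
    _ ≤ (x : ℝ) / Real.log x ^ A := div_le_div_of_nonneg_left hxpos.le hpowpos hx

/-- From an eventual lower bound `x/(log x)^A ≤ 3·#{n ≤ x : Q n}` the predicate `Q` holds beyond
every `N`. [folklore] -/
theorem unbounded_of_eventually_lower {Q : ℕ → Prop} [DecidablePred Q] {A : ℝ}
    (h : ∀ᶠ x : ℕ in atTop,
      (x : ℝ) / Real.log x ^ A ≤ 3 * ((((Finset.Icc 1 x).filter Q).card : ℕ) : ℝ)) :
    ∀ N : ℕ, ∃ n : ℕ, N ≤ n ∧ Q n := by
  intro N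
  by_contra hcon
  push Not at hcon
  have hcount : ∀ x : ℕ, ((((Finset.Icc 1 x).filter Q).card : ℕ) : ℝ) ≤ N := by
    intro x
    have hsub : (Finset.Icc 1 x).filter Q ⊆ Finset.range N := by
      intro n hn
      rw [Finset.mem_filter] at hn
      rw [Finset.mem_range]
      by_contra hlt
      exact hcon n (by omega) hn.2
    exact_mod_cast (Finset.card_le_card hsub).trans (Finset.card_range N).le
  obtain ⟨x, hx1, hx2, hx3⟩ :=
    (h.and ((eventually_sqrt_le_div_log_rpow A).and (eventually_ge_atTop ((3 * N + 1) ^ 2)))).exists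
  have hsq : (3 * (N : ℝ) + 1) ≤ Real.sqrt x := by
    rw [show (3 * (N : ℝ) + 1) = Real.sqrt ((3 * (N : ℝ) + 1) ^ 2) from
      (Real.sqrt_sq (by positivity)).symm]
    exact Real.sqrt_le_sqrt (by exact_mod_cast hx3)
  have := hcount x
  linarith

/-- **Teräväinen's Problem 3.2 from the crux (Ω-form).**  `RoughParityBalance` implies that
`Ω(n³ + 2)` is odd for infinitely many `n` (and even for infinitely many `n`). [folklore] -/
theorem problem_3_2_odd_of_roughParityBalance (hP : RoughParityBalance) :
    (∀ N : ℕ, ∃ n : ℕ, N ≤ n ∧ Odd (ArithmeticFunction.cardFactors (n ^ 3 + 2))) ∧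
    (∀ N : ℕ, ∃ n : ℕ, N ≤ n ∧ ¬ Odd (ArithmeticFunction.cardFactors (n ^ 3 + 2))) := by
  have hf : IsBatemanHornSystem ![(X ^ 3 + C ((2 : ℕ) : ℤ) : ℤ[X])] :=
    Literature.Barriers.Parity.UniformBatemanHornMatrix.isBatemanHornSystem_X_pow_add_C
      (d := 3) (by norm_num) (c := 2) (q := 2) Nat.prime_two (dvd_refl 2) (by norm_num)
  obtain ⟨A, hA⟩ := signCounts_of_roughParityBalance hP _ hf
  have heval : ∀ n : ℕ, (X ^ 3 + C ((2 : ℕ) : ℤ) : ℤ[X]).eval (n : ℤ) = ((n ^ 3 + 2 : ℕ) : ℤ) := by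
    intro n; simp [eval_add, eval_pow, eval_X]
  constructor
  · refine unbounded_of_eventually_lower (A := A) ?_
    filter_upwards [hA] with x hx
    refine hx.1.trans ?_
    refine mul_le_mul_of_nonneg_left ?_ (by norm_num)
    refine Nat.cast_le.mpr (Finset.card_le_card ?_)
    intro n hn
    rw [Finset.mem_filter] at hn ⊢
    refine ⟨hn.1, ?_⟩
    have h2 := hn.2.2
    rwa [heval n, Int.toNat_natCast] at h2
  · refine unbounded_of_eventually_lower (A := A) ?_
    filter_upwards [hA] with x hx
    refine hx.2.trans ?_
    refine mul_le_mul_of_nonneg_left ?_ (by norm_num)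
    refine Nat.cast_le.mpr (Finset.card_le_card ?_)
    intro n hn
    rw [Finset.mem_filter] at hn ⊢
    refine ⟨hn.1, ?_⟩
    have h2 := hn.2.2
    rwa [heval n, Int.toNat_natCast] at h2

/-- **Teräväinen's Problem 3.2 from the crux (λ-form, Mathlib's `ArithmeticFunction.liouville` and the
Literature rendering `liouvilleInt`).**  `RoughParityBalance → λ(n³+2) = −1` for infinitely many `n`.
Print status: OPEN — Teräväinen 2024 (arXiv:2010.07924) §3.4, Problem 3.2. [folklore] -/
theorem problem_3_2_of_roughParityBalance (hP : RoughParityBalance) :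
    ∀ N : ℕ, ∃ n : ℕ, N ≤ n ∧ ArithmeticFunction.liouville (n ^ 3 + 2) = -1 ∧
      liouvilleInt ((n : ℤ) ^ 3 + 2) = -1 := by
  intro N
  obtain ⟨n, hn, hodd⟩ := (problem_3_2_odd_of_roughParityBalance hP).1 N
  refine ⟨n, hn, ?_, ?_⟩
  · rw [ArithmeticFunction.liouville_apply (by positivity)]
    exact hodd.neg_one_pow
  · have hcast : ((n : ℤ) ^ 3 + 2).natAbs = n ^ 3 + 2 := by
      rw [show ((n : ℤ) ^ 3 + 2) = ((n ^ 3 + 2 : ℕ) : ℤ) by push_cast; ring]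
      exact Int.natAbs_natCast _
    rw [liouvilleInt, hcast, ArithmeticFunction.liouville_apply (by positivity)]
    exact hodd.neg_one_pow

end Summit.Parity.BatemanHorn.Cruxes.RoughParityBalance.StrategistR1
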